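import Summits.QuantumFields.YangMills.Theorems.UnitScaleTiltHistoryTailLowMassIntRows
import Summits.QuantumFields.YangMills.Theorems.UnitScaleTiltHistoryTailLowMassIntCL
import HarnessLib

/-!
# Route `UnitScaleTilt` — crux `HistoryTailL` (stmt-QuantumFields-19936), R-57χ successor line: THE PRICE OF THE INTERIOR WINDOW IN 4b's CONSTANT, EXPOSED
# (negation-lens pre-check N-g24-2 «bond-ball radius ÷ max(B₃,1), `CL ↦ CL + 9·log(max B₃ 1)` inside 4b's `∃ CL`», OWNER W-SEAT START LIST 2026-08-27T22:29Z
# «expose `CL += 9·log(max B₃ 1)` as a standalone lemma for the tribunal's T3 reading») — cell `ym3-torus`, width seat `ym-ust-19936-w2` (g0)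

**v4 F-2b TWIN** (★★OWNER RULING g26-№14, ★alpha-2 g7 checklist (s1)–(s7), cell `ym3-torus` 2026-08-28; width seat `ym-ust-19936-w7` g3): this file is ✓ `UnitScaleTiltHistoryTailLowMassIntCL` VERBATIM with
`PkgCoreV3 ↦ PkgCoreRows`, `dataIntV3 ↦ dataIntRows` (the generalised rows record of ✓ `AlphaInputsT3ACv4CoreRows`, fed by BOTH the v3 core (`PkgCoreV3.toRows`, by (69)–(71)) and the v4
package (`h71` per recorded plaquette)); namespace `…HistoryTailLowMassIntRows`; proofs unchanged.  The v3 original stays in the tree untouched.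

WHAT.  `HistoryTailLowMassInt.integral_low_ge` (p569299, the 4b engine at the INTERIOR datum of a family of data cores) bounds the window mass of the (47)-minorant by
`exp(−CL_int·x_k·N_k³)` with `CL_int = 2B₃² + 2 + CP + 3·log c⁻¹ + 9·(1 + log(8·max(B₃,1)/min(1,b₀)))`, whereas the OLD lineage's engine `HistoryTailLowMassV3.integral_low_ge`
(tower window, ball radius `min(1,b₀)g_k/8`) has `CL_old = 2B₃² + 2 + CP + 3·log c⁻¹ + 9·(1 + log(8/min(1,b₀)))`.  The registered 4b text hides the constant in `∃ CL`; for a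
reading of HOW the constant depends on the record this file exposes it:
* §1 `cl_int_eq_cl_old_add` — the identity `CL_int = CL_old + 9·log(max B₃ 1)` (pure `Real.log` algebra; `b₀ > 0`).
* §1 `integral_low_ge_explicit` — `integral_low_ge` with its exponent written as `(CL_old + 9·log(max B₃ 1))·x_k·N_k³`.
* §2 `lowMass_int_explicit_of_one_lt` — the 4b conclusion over the core family for every odd `L > 1` with the constant SPELLED OUT given the Haar small-ball constant `c`
  (`haar_real_ball_ge`: `c·r³ ≤ Haar{dist1 ≤ r}` on `(0,1]`): only the γ-threshold stays existential (`γb = min γθ a₁²`, `γθ` from `T3Thresholds.exists_gamma_forall_θBal_le` at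
  `σ = 1`, a function of `(b₀, p₀)` alone).  So `CL` depends on `(B₃, b₀, CP, c)` only — not on `γ`, `K`, `j`, `L`, the family `F` or the data cores — and the interior window
  costs exactly the additive `9·log(max B₃ 1)`.  (With `c` from `HistoryTailLowMass.haar_real_ball_ge` the pair `(CL_old + 9·log(max B₃ 1), γb)` witnesses p569299's
  `lowMass_int_of_one_lt`'s `∃ CL γb` — not restated here.)
HONEST FRAMING.  Bookkeeping only (re-packaging of p569299's theorem); CONDITIONAL on the core family `qf` like its parent; nothing of [Balaban1985UV3] or [Balaban1985Variational]
is asserted; count-neutral helper (`--supports stmt-QuantumFields-19936`); registry untouched.  YM₃ on the torus is a RUNG of the programme, not the Clay problem; no claim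
about d = 4, infinite volume, or a mass gap.
[cite: Balaban1985UV3, (47) p.267 and Thm 1 (5) p.256; Balaban1985Variational, Thm 1 (8) p.279]
-/

noncomputable section

namespace Summit.QuantumFields.YangMills.Theorems.HistoryTailLowMassIntRows

open MeasureTheory
open scoped Matrix.Norms.L2Operator
open Literature.MathematicalPhysics.QuantumFieldTheory.Balaban1983to89
open Literature.MathematicalPhysics.QuantumFieldTheory.Balaban1983to89.T3ContinuumYM3Torus
open Literature.MathematicalPhysics.QuantumFieldTheory.Balaban1983to89.T3UnitLawDensityEML (ℰp)
open Literature.MathematicalPhysics.QuantumFieldTheory.Balaban1983to89.T3UnitScaleTilt (θBal)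
open Literature.MathematicalPhysics.QuantumFieldTheory.Balaban1983to89.T3AlphaInputsAC
open Summit.QuantumFields.Balaban3D.Carriers (suGroupModel Hist)
open Summit.QuantumFields.Balaban3D.Proofs.Primitives (AlphaConsts)
open Summit.QuantumFields.YangMills.Theorems.HistoryTailLowMassInt (cl_int_eq_cl_old_add)

/-! ## §1 The identity and the explicit-constant form of the engine -/

-- `cl_int_eq_cl_old_add` (the price of the interior window) is ✓ `HistoryTailLowMassInt.cl_int_eq_cl_old_add` of the v3 original, used BY NAME (no restatement).

section Assembly

variable {F : T3Family} {𝔠 : AlphaConsts F.L (suGroupModel 2).N} {γ : ℝ} {hγ : 0 < γ} {hγ1 : γ ≤ (min 𝔠.gamma0 1) ^ 2}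
  (qf : ∀ K, AlphaInputsT3AC.PkgCoreRows F 𝔠 γ hγ hγ1 K) (π : AlphaInputsT3AC.PolymerT3 F)

/-- **THE WINDOW MASS OF THE MINORANT, EXPLICIT CONSTANT**: `integral_low_ge` with the exponent written as `(CL_old + 9·log(max B₃ 1))·x_k·N_k³`,
`CL_old = 2B₃² + 2 + CP + 3·log c⁻¹ + 9·(1 + log(8/min(1,b₀)))` the old lineage's constant (`HistoryTailLowMassV3.integral_low_ge`).
[cite: Balaban1985UV3, (47) p.267 and Thm 1 (5) p.256] -/
theorem integral_low_ge_explicit {CP : ℝ} (hCP : 0 ≤ CP) (hPS : PintSize (AlphaInputsT3AC.dataIntRows qf π) 𝔠.b₀ 𝔠.p₀ CP)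
    (hθ1 : ∀ i, θBal F.L γ 𝔠.b₀ 𝔠.p₀ i ≤ 1) (hγ1' : γ ≤ 1) {c : ℝ} (hc0 : 0 < c) (hc1 : c ≤ 1)
    (hball : ∀ r : ℝ, 0 < r → r ≤ 1 →
      c * r ^ 3 ≤ (HaarData.haar (G := Matrix.specialUnitaryGroup (Fin 2) ℂ)).real
        {g : Matrix.specialUnitaryGroup (Fin 2) ℂ | dist1 g ≤ r})
    (K k : ℕ) (hk : k ≤ K)
    (hmain : ∀ W : GaugeField (F.P K) k (Matrix.specialUnitaryGroup (Fin 2) ℂ),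
      PlaqSmall (min 1 𝔠.b₀ * Real.sqrt (γ * ((F.L : ℝ)⁻¹) ^ (K - k))) W →
        (F.scheme ℰp γ).β K *
            wilsonAction4 ((AlphaInputsT3AC.dataIntRows qf π).Umin K k ((AlphaInputsT3AC.dataIntRows qf π).triv K k) W) ≤
          (2 * 𝔠.B₃ ^ 2 + 2) * ((F.P K).sitesPerDir k : ℝ) ^ 3) :
    Real.exp (-(((2 * 𝔠.B₃ ^ 2 + 2 + CP + 3 * Real.log c⁻¹ + 9 * (1 + Real.log (8 / min 1 𝔠.b₀))) + 9 * Real.log (max 𝔠.B₃ 1)) *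
        (1 + Real.log (Real.sqrt (γ * ((F.L : ℝ)⁻¹) ^ (K - k)))⁻¹) * ((F.P K).sitesPerDir k : ℝ) ^ 3)) ≤
      ∫ W, (AlphaInputsT3AC.dataIntRows qf π).low K k W ∂fieldMeasure (F.P K) k (Matrix.specialUnitaryGroup (Fin 2) ℂ) := by
  rw [← cl_int_eq_cl_old_add 𝔠.B₃ CP c 𝔠.b₀_pos]
  exact integral_low_ge qf π hCP hPS hθ1 hγ1' hc0 hc1 hball K k hk hmain

end Assembly

/-! ## §2 4b over the core family with the constant spelled out -/

/-- **4b FOR EVERY ODD BLOCK SIZE `L > 1`, EXPLICIT CONSTANT**: `lowMass_int_of_one_lt` with `CL := CL_old(B₃, b₀, CP, c) + 9·log(max B₃ 1)` SPELLED OUT for any Haar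
small-ball constant `c` (`haar_real_ball_ge`); only the γ-threshold `γb` (`= min γθ a₁²`, `γθ` a function of `(b₀, p₀)`) stays existential.  The constant does not depend on
`γ`, `K`, `j`, `L`, the family or the data cores. [cite: Balaban1985UV3, (47) p.267 and (5) p.256; Balaban1985Variational, Thm 1 (8) p.279] -/
theorem lowMass_int_explicit_of_one_lt :
    ∀ (L : ℕ), Odd L → 1 < L →
      ∀ (𝔠 : AlphaConsts L (suGroupModel 2).N) (a₁ : ℝ), 0 < a₁ → ∀ (CP : ℝ), 0 ≤ CP →
        ∀ (c : ℝ), 0 < c → c ≤ 1 →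
          (∀ r : ℝ, 0 < r → r ≤ 1 →
            c * r ^ 3 ≤ (HaarData.haar (G := Matrix.specialUnitaryGroup (Fin 2) ℂ)).real {g : Matrix.specialUnitaryGroup (Fin 2) ℂ | dist1 g ≤ r}) →
          ∃ γb : ℝ, 0 < γb ∧
          ∀ (F : T3Family) (hF : F.L = L) (γ : ℝ) (hγ : 0 < γ) (hγ1 : γ ≤ (min (hF ▸ 𝔠).gamma0 1) ^ 2)
            (qf : ∀ K, AlphaInputsT3AC.PkgCoreRows F (hF ▸ 𝔠) γ hγ hγ1 K) (π : AlphaInputsT3AC.PolymerT3 F), (∀ K, (qf K).a₁ = a₁) → γ ≤ γb →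
            PintSize (AlphaInputsT3AC.dataIntRows qf π) (hF ▸ 𝔠).b₀ (hF ▸ 𝔠).p₀ CP →
            ∀ (K j : ℕ), j ≤ K →
              Real.exp (-(((2 * 𝔠.B₃ ^ 2 + 2 + CP + 3 * Real.log c⁻¹ + 9 * (1 + Real.log (8 / min 1 𝔠.b₀))) + 9 * Real.log (max 𝔠.B₃ 1)) *
                  (1 + Real.log (Real.sqrt (γ * ((F.L : ℝ)⁻¹) ^ (K - j)))⁻¹) * ((F.P K).sitesPerDir j : ℝ) ^ 3)) ≤
                ∫ Wf, (AlphaInputsT3AC.dataIntRows qf π).low K j Wf ∂fieldMeasure (F.P K) j (Matrix.specialUnitaryGroup (Fin 2) ℂ) := by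
  intro L hLo hL1' 𝔠 a₁ ha1 CP hCP c hc0 hc1 hball
  obtain ⟨γθ, hγθ, hγθ1, hθle⟩ := T3Thresholds.exists_gamma_forall_θBal_le 𝔠.b₀_pos 𝔠.p₀_pos one_pos
  have ht0 : 0 < min 1 𝔠.b₀ := lt_min one_pos 𝔠.b₀_pos
  refine ⟨min γθ (a₁ ^ 2), lt_min hγθ (by positivity), ?_⟩
  intro F hF γ hγ hγ1 qf π hq hγb hPS K j hjK
  subst hF
  have hγθ' : γ ≤ γθ := hγb.trans (min_le_left _ _)
  have hγa : γ ≤ a₁ ^ 2 := hγb.trans (min_le_right _ _)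
  have hγ1' : γ ≤ 1 := hγθ'.trans hγθ1
  have hL1 : 1 ≤ F.L := F.hL.2.le
  have hθ1 : ∀ i, θBal F.L γ 𝔠.b₀ 𝔠.p₀ i ≤ 1 := fun i => hθle F.L hL1 γ hγ hγθ' i
  -- `ε₁ := min(1,b₀)·g_i` is positive, `≤ a₁ = (qf K).a₁`, and `ε₁² ≤ g_i²`
  have hsmall : ∀ i : ℕ, 0 < min 1 𝔠.b₀ * Real.sqrt (γ * ((F.L : ℝ)⁻¹) ^ i) ∧
      min 1 𝔠.b₀ * Real.sqrt (γ * ((F.L : ℝ)⁻¹) ^ i) ≤ (qf K).a₁ ∧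
      (min 1 𝔠.b₀ * Real.sqrt (γ * ((F.L : ℝ)⁻¹) ^ i)) ^ 2 ≤ γ * ((F.L : ℝ)⁻¹) ^ i := by
    intro i
    obtain ⟨hg0, hgle⟩ := T3ThresholdSmallness.sqrt_coupling_pos_le hL1 hγ i
    have hεg : min 1 𝔠.b₀ * Real.sqrt (γ * ((F.L : ℝ)⁻¹) ^ i) ≤ Real.sqrt (γ * ((F.L : ℝ)⁻¹) ^ i) :=
      mul_le_of_le_one_left hg0.le (min_le_left _ _)
    have hga : Real.sqrt γ ≤ a₁ := by
      rw [← Real.sqrt_sq ha1.le]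
      exact Real.sqrt_le_sqrt hγa
    refine ⟨mul_pos ht0 hg0, (hq K).symm ▸ hεg.trans (hgle.trans hga), ?_⟩
    have h2 := pow_le_pow_left₀ (mul_pos ht0 hg0).le hεg 2
    rwa [Real.sq_sqrt (by positivity)] at h2
  rcases Nat.eq_zero_or_pos j with hj0 | hjpos
  · subst hj0
    exact integral_low_ge_explicit qf π hCP hPS hθ1 hγ1' hc0 hc1 hball K 0 (Nat.zero_le K)
      (fun W hW => mainT_le_of_small_zero qf π K (hsmall (K - 0)).2.2 W hW)
  · have hA : ∀ W : GaugeField (F.P K) (K - (K - j)) (Matrix.specialUnitaryGroup (Fin 2) ℂ),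
        PlaqSmall (min 1 𝔠.b₀ * Real.sqrt (γ * ((F.L : ℝ)⁻¹) ^ (K - j))) W →
          (F.scheme ℰp γ).β K *
              wilsonAction4 ((AlphaInputsT3AC.dataIntRows qf π).Umin K (K - (K - j))
                ((AlphaInputsT3AC.dataIntRows qf π).triv K (K - (K - j))) W) ≤
            (2 * 𝔠.B₃ ^ 2 + 2) * ((F.P K).sitesPerDir (K - (K - j)) : ℝ) ^ 3 :=
      fun W hW => mainT_le_of_small_pos qf π K (K - j) (by omega) (hsmall (K - j)).1 (hsmall (K - j)).2.1
        (hsmall (K - j)).2.2 W hW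
    rw [Nat.sub_sub_self hjK] at hA
    exact integral_low_ge_explicit qf π hCP hPS hθ1 hγ1' hc0 hc1 hball K j hjK hA

end Summit.QuantumFields.YangMills.Theorems.HistoryTailLowMassIntRows

end
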